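import Mathlib.GroupTheory.QuotientGroup.Basic
import Literature.NumberTheory.Automorphic.BrandtModuleMatrixUnits
import Literature.NumberTheory.Automorphic.BrandtModuleMaximalLocal
import HarnessLib

/-!
# Lattices over a residually split order: the module dictionary

Fifteenth layer of the proof files for the named fact `brandtMatrix_comm` of `BrandtModule.lean`
(Vignéras, LNM 800, III §5 ex. 5.8; Eichler 1973, II §6 Thm. 2). For a `ℤ`-order `O` with
matrix units `e, u, v` modulo `p` (`IsMatrixUnitsMod`, the data of `IsResiduallySplit`) and right
`O`-lattices `K ≤ M` with `p M ⊆ K`, the finite group `M / K` (`LatQuot M K`) carries the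
matrix-unit action of `BrandtModuleMatrixUnits.lean` (`isMatrixUnitAction_actQ`), and right
`O`-lattices `J` between `K` and `M` correspond to stable subgroups, with `|J / K| = [J : K]`
(`subOf`, `latOf`, `card_subOf`). Consequences:

* `card_between_eq_one` / `card_between_eq_succ` — the number of right `O`-lattices `J`,
  `K ≤ J ≤ M`, with `[J : K] = p²` is `1` if `[M : K] = p²` and `p + 1` if `[M : K] = p⁴`;
* `relIndex_eq_corner_sq` — `[M : K]` is a perfect square;
* `exists_generator_mod` — if `[M : p M] = p⁴` then some `y ∈ M` lies in no proper right
  `O`-lattice between `p M` and `M` (`M = y O + p M`).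

## References

* M. Eichler, *The basis problem for modular forms and the traces of the Hecke operators*,
  LNM 320 (1973), Ch. II §6, proof of Thm. 2 [Eichler1973].
* M.-F. Vignéras, *Arithmétique des algèbres de quaternions*, LNM 800 (1980), Ch. II §2
  (idéaux de `M₂(ℤ_p)`) [VignerasLNM800].
-/

noncomputable section

open scoped Pointwise

universe u

namespace Literature.NumberTheory.Automorphic

variable {B : Type u} [Ring B]

/-! ### Matrix units modulo `p` -/

/-- **Matrix units modulo `p`** in an order `O`: the data of `IsResiduallySplit` with the
witnesses `e, u, v` exposed. [cite: VignerasLNM800, Ch. II §2 Thm. 2.3] -/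
structure IsMatrixUnitsMod (O : Submodule ℤ B) (p : ℕ) (e u v : B) : Prop where
  /-- `e ∈ O`. -/
  e_mem : e ∈ O
  /-- `u ∈ O`. -/
  u_mem : u ∈ O
  /-- `v ∈ O`. -/
  v_mem : v ∈ O
  /-- `e² ≡ e`. -/
  ee : e * e - e ∈ (p : ℤ) • O
  /-- `e u ≡ u`. -/
  eu : e * u - u ∈ (p : ℤ) • O
  /-- `u e ≡ 0`. -/
  ue : u * e ∈ (p : ℤ) • O
  /-- `u² ≡ 0`. -/
  uu : u * u ∈ (p : ℤ) • O
  /-- `v² ≡ 0`. -/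
  vv : v * v ∈ (p : ℤ) • O
  /-- `e v ≡ 0`. -/
  ev : e * v ∈ (p : ℤ) • O
  /-- `v e ≡ v`. -/
  ve : v * e - v ∈ (p : ℤ) • O
  /-- `u v ≡ e`. -/
  uv : u * v - e ∈ (p : ℤ) • O
  /-- `v u ≡ 1 − e`. -/
  vu : v * u - (1 - e) ∈ (p : ℤ) • O
  /-- `e, u, v, 1 − e` span `O` modulo `p O`. -/
  span : ∀ x ∈ O, ∃ a b c d : ℤ, x - (a • e + b • u + c • v + d • (1 - e)) ∈ (p : ℤ) • O

/-- A residually split order has matrix units modulo `p`. [folklore] -/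
theorem IsZOrder.IsResiduallySplit.exists_isMatrixUnitsMod {O : Submodule ℤ B} {hO : IsZOrder O} {p : ℕ}
    (h : hO.IsResiduallySplit p) : ∃ e u v : B, IsMatrixUnitsMod O p e u v := by
  obtain ⟨e, u, v, he, hu, hv, r1, r2, r3, r4, r5, r6, r7, r8, r9, hspan⟩ := h
  exact ⟨e, u, v, ⟨he, hu, hv, r1, r2, r3, r4, r5, r6, r7, r8, r9, hspan⟩⟩

/-! ### The finite quotient `M / K` of two lattices and the right multiplication action -/

section LatQuot

variable (M K : Submodule ℤ B)

/-- `K ∩ M` as a subgroup of `M`. [folklore] -/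
def latRes : AddSubgroup M := (K.comap M.subtype).toAddSubgroup

/-- The quotient group `M / (K ∩ M)`. [folklore] -/
abbrev LatQuot : Type u := M ⧸ latRes M K

/-- The projection `M → M / K`. [folklore] -/
abbrev latMk : M →+ LatQuot M K := QuotientAddGroup.mk' (latRes M K)

variable {M K}

/-- Membership in `latRes` (definitional). [folklore] -/
theorem mem_latRes {x : M} : x ∈ latRes M K ↔ (x : B) ∈ K := Iff.rfl

/-- Two elements of `M` have the same class iff their difference lies in `K`. [folklore] -/
theorem latMk_eq_latMk_iff {x y : M} : latMk M K x = latMk M K y ↔ (x : B) - y ∈ K := by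
  rw [QuotientAddGroup.mk'_apply, QuotientAddGroup.mk'_apply, QuotientAddGroup.eq, mem_latRes,
    AddMemClass.coe_add, NegMemClass.coe_neg, neg_add_eq_sub, ← Submodule.neg_mem_iff, neg_sub]

/-- `latMk x = 0 ↔ x ∈ K`. [folklore] -/
theorem latMk_eq_zero_iff {x : M} : latMk M K x = 0 ↔ (x : B) ∈ K := by
  rw [QuotientAddGroup.mk'_apply, QuotientAddGroup.eq_zero_iff, mem_latRes]

/-- **`|M / K| = [M : K]`.** [folklore] -/
theorem card_latQuot : Nat.card (LatQuot M K) = K.toAddSubgroup.relIndex M.toAddSubgroup :=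
  (AddSubgroup.index_eq_card _).symm

/-- Right multiplication by `z` on `M` (for `M z ⊆ M`). [folklore] -/
def mulRightRes (z : B) (hM : ∀ x ∈ M, x * z ∈ M) : M →+ M where
  toFun x := ⟨x.1 * z, hM _ x.2⟩
  map_zero' := Subtype.ext (by simp)
  map_add' x y := Subtype.ext (by simp [add_mul])

/-- Right multiplication by `z` on `M / K` (for `M z ⊆ M`, `K z ⊆ K`). [folklore] -/
def actQ (z : B) (hM : ∀ x ∈ M, x * z ∈ M) (hK : ∀ x ∈ K, x * z ∈ K) : LatQuot M K →+ LatQuot M K :=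
  QuotientAddGroup.map _ _ (mulRightRes z hM) fun _ hx => hK _ hx

/-- `actQ z (mk x) = mk (x z)`. [folklore] -/
theorem actQ_mk (z : B) (hM : ∀ x ∈ M, x * z ∈ M) (hK : ∀ x ∈ K, x * z ∈ K) (x : M) :
    actQ z hM hK (latMk M K x) = latMk M K ⟨x.1 * z, hM _ x.2⟩ :=
  QuotientAddGroup.map_mk' _ _ _ _ x

end LatQuot

/-! ### The matrix-unit action on `M / K` -/

section Action

variable {O : Submodule ℤ B} {p : ℕ} {e u v : B} {M K : Submodule ℤ B}

/-- Hypotheses on the pair `K ≤ M`: right `O`-lattices with `p M ⊆ K`. [folklore] -/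
structure IsLatticePair (O : Submodule ℤ B) (p : ℕ) (M K : Submodule ℤ B) : Prop where
  /-- `K ≤ M`. -/
  le : K ≤ M
  /-- `M O ⊆ M`. -/
  mul_mem_M : ∀ x ∈ M, ∀ o ∈ O, x * o ∈ M
  /-- `K O ⊆ K`. -/
  mul_mem_K : ∀ x ∈ K, ∀ o ∈ O, x * o ∈ K
  /-- `p M ⊆ K`. -/
  smul_mem : ∀ x ∈ M, (p : ℤ) • x ∈ K

variable (hmu : IsMatrixUnitsMod O p e u v) (hMK : IsLatticePair O p M K)

/-- `M (p O) ⊆ K`. [folklore] -/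
theorem IsLatticePair.mul_mem_of_mem_smul (hMK : IsLatticePair O p M K) {x z : B} (hx : x ∈ M)
    (hz : z ∈ (p : ℤ) • O) : x * z ∈ K := by
  obtain ⟨o, ho, rfl⟩ := (Submodule.mem_smul_pointwise_iff_exists _ _ O).mp hz
  rw [mul_smul_comm]
  exact hMK.smul_mem _ (hMK.mul_mem_M _ hx _ ho)

/-- The action of `e` on `M / K`. [folklore] -/
abbrev actE (hmu : IsMatrixUnitsMod O p e u v) (hMK : IsLatticePair O p M K) : LatQuot M K →+ LatQuot M K :=
  actQ e (fun x hx => hMK.mul_mem_M x hx e hmu.e_mem) (fun x hx => hMK.mul_mem_K x hx e hmu.e_mem)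

/-- The action of `u` on `M / K`. [folklore] -/
abbrev actU (hmu : IsMatrixUnitsMod O p e u v) (hMK : IsLatticePair O p M K) : LatQuot M K →+ LatQuot M K :=
  actQ u (fun x hx => hMK.mul_mem_M x hx u hmu.u_mem) (fun x hx => hMK.mul_mem_K x hx u hmu.u_mem)

/-- The action of `v` on `M / K`. [folklore] -/
abbrev actV (hmu : IsMatrixUnitsMod O p e u v) (hMK : IsLatticePair O p M K) : LatQuot M K →+ LatQuot M K :=
  actQ v (fun x hx => hMK.mul_mem_M x hx v hmu.v_mem) (fun x hx => hMK.mul_mem_K x hx v hmu.v_mem)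

include hmu hMK in
/-- **`M / K` is an `M₂(𝔽_p)`-module**: the actions of `e, u, v` satisfy the matrix-unit relations. [folklore] -/
theorem isMatrixUnitAction_actQ : IsMatrixUnitAction (actE hmu hMK) (actU hmu hMK) (actV hmu hMK) := by
  have hsurj := QuotientAddGroup.mk'_surjective (latRes M K)
  -- a relation `x (y z) ≡ x w` from `y z − w ∈ p O`
  have key : ∀ {a b : B} (ha : a ∈ M) (hb : b ∈ M), a - b ∈ K →
      latMk M K ⟨a, ha⟩ = latMk M K ⟨b, hb⟩ := fun ha hb h => latMk_eq_latMk_iff.mpr h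
  refine ⟨?_, ?_, ?_, ?_, ?_, ?_, ?_, ?_, ?_⟩ <;> intro y <;> obtain ⟨x, rfl⟩ := hsurj y <;>
    simp only [actQ_mk]
  · refine key _ _ ?_
    rw [mul_assoc, ← mul_sub]; exact hMK.mul_mem_of_mem_smul x.2 hmu.ee
  · refine key _ _ ?_
    rw [mul_assoc, ← mul_sub]; exact hMK.mul_mem_of_mem_smul x.2 hmu.eu
  · rw [latMk_eq_zero_iff]
    simpa only [mul_assoc] using hMK.mul_mem_of_mem_smul x.2 hmu.ue
  · rw [latMk_eq_zero_iff]
    simpa only [mul_assoc] using hMK.mul_mem_of_mem_smul x.2 hmu.uu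
  · rw [latMk_eq_zero_iff]
    simpa only [mul_assoc] using hMK.mul_mem_of_mem_smul x.2 hmu.vv
  · rw [latMk_eq_zero_iff]
    simpa only [mul_assoc] using hMK.mul_mem_of_mem_smul x.2 hmu.ev
  · refine key _ _ ?_
    rw [mul_assoc, ← mul_sub]; exact hMK.mul_mem_of_mem_smul x.2 hmu.ve
  · refine key _ _ ?_
    rw [mul_assoc, ← mul_sub]; exact hMK.mul_mem_of_mem_smul x.2 hmu.uv
  · change latMk M K _ = latMk M K x - latMk M K _
    rw [← map_sub, latMk_eq_latMk_iff, Submodule.coe_sub]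
    have : (x : B) * v * u - ((x : B) - x * e) = x * (v * u - (1 - e)) := by noncomm_ring
    rw [this]
    exact hMK.mul_mem_of_mem_smul x.2 hmu.vu

include hMK in
/-- `p (M / K) = 0`. [folklore] -/
theorem smul_latQuot_eq_zero (y : LatQuot M K) : p • y = 0 := by
  obtain ⟨x, rfl⟩ := QuotientAddGroup.mk'_surjective (latRes M K) y
  rw [← map_nsmul, latMk_eq_zero_iff, Submodule.coe_smul_of_tower, ← natCast_zsmul]
  exact hMK.smul_mem _ x.2

/-! ### The dictionary: lattices between `K` and `M` and subgroups of `M / K` -/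

/-- The subgroup `J / K ≤ M / K` of a lattice `J`. [folklore] -/
def subOf (M K J : Submodule ℤ B) : AddSubgroup (LatQuot M K) :=
  ((J.comap M.subtype).toAddSubgroup).map (latMk M K)

/-- The lattice `{x ∈ M | x̄ ∈ S}` of a subgroup `S ≤ M / K`. [folklore] -/
def latOf (M K : Submodule ℤ B) (S : AddSubgroup (LatQuot M K)) : Submodule ℤ B :=
  AddSubgroup.toIntSubmodule ((S.comap (latMk M K)).map M.subtype.toAddMonoidHom)

omit hMK in
/-- Membership in `latOf S`. [folklore] -/
theorem mem_latOf {S : AddSubgroup (LatQuot M K)} {x : B} :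
    x ∈ latOf M K S ↔ ∃ hx : x ∈ M, latMk M K ⟨x, hx⟩ ∈ S := by
  change x ∈ ((S.comap (latMk M K)).map M.subtype.toAddMonoidHom) ↔ _
  constructor
  · rintro ⟨y, hy, rfl⟩
    exact ⟨y.2, hy⟩
  · rintro ⟨hx, h⟩
    exact ⟨⟨x, hx⟩, h, rfl⟩

omit hMK in
/-- Membership in `subOf J`. [folklore] -/
theorem mem_subOf {J : Submodule ℤ B} {y : LatQuot M K} :
    y ∈ subOf M K J ↔ ∃ x : M, (x : B) ∈ J ∧ latMk M K x = y := by
  change y ∈ ((J.comap M.subtype).toAddSubgroup).map (latMk M K) ↔ _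
  constructor
  · rintro ⟨x, hx, rfl⟩; exact ⟨x, hx, rfl⟩
  · rintro ⟨x, hx, rfl⟩; exact ⟨x, hx, rfl⟩

omit hMK in
/-- `latOf S ≤ M`. [folklore] -/
theorem latOf_le (S : AddSubgroup (LatQuot M K)) : latOf M K S ≤ M := fun _ hx => (mem_latOf.mp hx).1

omit hMK in
/-- `K ≤ latOf S`. [folklore] -/
theorem le_latOf (hKM : K ≤ M) (S : AddSubgroup (LatQuot M K)) : K ≤ latOf M K S := fun x hx =>
  mem_latOf.mpr ⟨hKM hx, by rw [latMk_eq_zero_iff.mpr hx]; exact S.zero_mem⟩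

omit hMK in
/-- `subOf (latOf S) = S`. [folklore] -/
theorem subOf_latOf (S : AddSubgroup (LatQuot M K)) : subOf M K (latOf M K S) = S := by
  ext y
  rw [mem_subOf]
  constructor
  · rintro ⟨x, hx, rfl⟩
    obtain ⟨hx', h⟩ := mem_latOf.mp hx
    simpa using h
  · intro hy
    obtain ⟨x, rfl⟩ := QuotientAddGroup.mk'_surjective (latRes M K) y
    exact ⟨x, mem_latOf.mpr ⟨x.2, hy⟩, rfl⟩

omit hMK in
/-- `latOf (subOf J) = J` for `K ≤ J ≤ M`. [folklore] -/
theorem latOf_subOf {J : Submodule ℤ B} (hKJ : K ≤ J) (hJM : J ≤ M) : latOf M K (subOf M K J) = J := by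
  ext x
  rw [mem_latOf]
  constructor
  · rintro ⟨hx, h⟩
    obtain ⟨y, hy, hyx⟩ := mem_subOf.mp h
    have hdiff : (y : B) - x ∈ K := latMk_eq_latMk_iff.mp hyx
    have : x = y - (y - x) := by abel
    rw [this]
    exact J.sub_mem hy (hKJ hdiff)
  · intro hx
    exact ⟨hJM hx, mem_subOf.mpr ⟨⟨x, hJM hx⟩, hx, rfl⟩⟩

omit hMK in
/-- **`|J / K| = [J : K]`** for `J ≤ M`. [folklore] -/
theorem card_subOf {J : Submodule ℤ B} (hJM : J ≤ M) :
    Nat.card (subOf M K J) = K.toAddSubgroup.relIndex J.toAddSubgroup := by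
  set H : AddSubgroup M := (J.comap M.subtype).toAddSubgroup
  set f : H →+ LatQuot M K := (latMk M K).comp H.subtype
  have hrange : f.range = subOf M K J := by
    rw [AddMonoidHom.range_comp, AddSubgroup.range_subtype]; rfl
  have hker : f.ker = (latRes M K).addSubgroupOf H := by
    ext x
    rw [AddMonoidHom.mem_ker, AddSubgroup.mem_addSubgroupOf, AddMonoidHom.comp_apply,
      AddSubgroup.coe_subtype, latMk_eq_zero_iff, mem_latRes]
  rw [← hrange, ← Nat.card_congr (QuotientAddGroup.quotientKerEquivRange f).toEquiv, hker]
  change ((latRes M K).addSubgroupOf H).index = _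
  have h1 : ((latRes M K).addSubgroupOf H).index = (latRes M K).relIndex H := rfl
  rw [h1]
  have h2 : latRes M K = K.toAddSubgroup.addSubgroupOf M.toAddSubgroup := rfl
  have h3 : H = J.toAddSubgroup.addSubgroupOf M.toAddSubgroup := rfl
  rw [h2, h3, AddSubgroup.relIndex_addSubgroupOf (Submodule.toAddSubgroup_mono hJM)]

include hmu hMK in
/-- A right `O`-lattice `J` between `K` and `M` gives a stable subgroup. [folklore] -/
theorem isStable_subOf {J : Submodule ℤ B} (hJO : ∀ x ∈ J, ∀ o ∈ O, x * o ∈ J) :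
    IsMatrixUnitAction.IsStable (actE hmu hMK) (actU hmu hMK) (actV hmu hMK) (subOf M K J) := by
  intro y hy
  obtain ⟨x, hx, rfl⟩ := mem_subOf.mp hy
  simp only [actQ_mk]
  exact ⟨mem_subOf.mpr ⟨_, hJO _ hx _ hmu.e_mem, rfl⟩, mem_subOf.mpr ⟨_, hJO _ hx _ hmu.u_mem, rfl⟩,
    mem_subOf.mpr ⟨_, hJO _ hx _ hmu.v_mem, rfl⟩⟩

include hmu hMK in
/-- A stable subgroup gives a right `O`-lattice (decompose `o ∈ O` along `e, u, v, 1 − e`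
modulo `p O`). [folklore] -/
theorem mul_mem_latOf {S : AddSubgroup (LatQuot M K)}
    (hS : IsMatrixUnitAction.IsStable (actE hmu hMK) (actU hmu hMK) (actV hmu hMK) S) :
    ∀ x ∈ latOf M K S, ∀ o ∈ O, x * o ∈ latOf M K S := by
  intro x hx o ho
  obtain ⟨hxM, hxS⟩ := mem_latOf.mp hx
  obtain ⟨a, b, c, d, hz⟩ := hmu.span o ho
  have hxo : x * o ∈ M := hMK.mul_mem_M _ hxM _ ho
  refine mem_latOf.mpr ⟨hxo, ?_⟩
  obtain ⟨hE, hU, hV⟩ := hS _ hxS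
  simp only [actQ_mk] at hE hU hV
  -- `x o = a xe + b xu + c xv + d x − d xe + x z`
  have hxz : x * (o - (a • e + b • u + c • v + d • (1 - e))) ∈ K := hMK.mul_mem_of_mem_smul hxM hz
  have heq : latMk M K ⟨x * o, hxo⟩ =
      a • latMk M K ⟨x * e, hMK.mul_mem_M _ hxM _ hmu.e_mem⟩ + b • latMk M K ⟨x * u, hMK.mul_mem_M _ hxM _ hmu.u_mem⟩
        + c • latMk M K ⟨x * v, hMK.mul_mem_M _ hxM _ hmu.v_mem⟩
        + (d • latMk M K ⟨x, hxM⟩ - d • latMk M K ⟨x * e, hMK.mul_mem_M _ hxM _ hmu.e_mem⟩) := by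
    rw [← map_zsmul, ← map_zsmul, ← map_zsmul, ← map_zsmul, ← map_zsmul, ← map_sub, ← map_add,
      ← map_add, ← map_add, latMk_eq_latMk_iff]
    simp only [Submodule.coe_add, Submodule.coe_sub, Submodule.coe_smul_of_tower]
    have : x * o - (a • (x * e) + b • (x * u) + c • (x * v) + (d • x - d • (x * e))) =
        x * (o - (a • e + b • u + c • v + d • (1 - e))) := by
      simp only [mul_sub, mul_add, mul_smul_comm, smul_sub, mul_one]
    rw [this]
    exact hxz
  rw [heq]
  exact S.add_mem (S.add_mem (S.add_mem (S.zsmul_mem hE _) (S.zsmul_mem hU _)) (S.zsmul_mem hV _))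
    (S.sub_mem (S.zsmul_mem hxS _) (S.zsmul_mem hE _))

/-- **The dictionary**: right `O`-lattices `J` with `K ≤ J ≤ M` and `[J : K] = n²` correspond to
stable subgroups of `M / K` of order `n²`. [folklore] -/
def betweenEquiv (hmu : IsMatrixUnitsMod O p e u v) (hMK : IsLatticePair O p M K) (n : ℕ) :
    {J : Submodule ℤ B // K ≤ J ∧ J ≤ M ∧ (∀ x ∈ J, ∀ o ∈ O, x * o ∈ J) ∧
        K.toAddSubgroup.relIndex J.toAddSubgroup = n ^ 2} ≃
      {S : AddSubgroup (LatQuot M K) //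
        IsMatrixUnitAction.IsStable (actE hmu hMK) (actU hmu hMK) (actV hmu hMK) S ∧ Nat.card S = n ^ 2} where
  toFun J := ⟨subOf M K J.1, isStable_subOf hmu hMK J.2.2.2.1, by rw [card_subOf J.2.2.1, J.2.2.2.2]⟩
  invFun S := ⟨latOf M K S.1, le_latOf hMK.le _, latOf_le _, mul_mem_latOf hmu hMK S.2.1, by
    rw [← card_subOf (latOf_le S.1), subOf_latOf, S.2.2]⟩
  left_inv J := Subtype.ext (latOf_subOf J.2.1 J.2.2.1)
  right_inv S := Subtype.ext (subOf_latOf S.1)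

include hmu hMK in
/-- **`[M : K]` is a perfect square**, the square of the order of the corner of `M / K`. [folklore] -/
theorem relIndex_eq_corner_sq :
    K.toAddSubgroup.relIndex M.toAddSubgroup =
      Nat.card (IsMatrixUnitAction.corner (actE hmu hMK) (⊤ : AddSubgroup (LatQuot M K))) ^ 2 := by
  rw [← card_latQuot, ← AddSubgroup.card_top (G := LatQuot M K)]
  exact (isMatrixUnitAction_actQ hmu hMK).card_eq_corner_sq fun x _ =>
    ⟨AddSubgroup.mem_top _, AddSubgroup.mem_top _, AddSubgroup.mem_top _⟩

include hmu in
/-- **Count, case `[M : K] = p²`**: exactly one right `O`-lattice `J` with `K ≤ J ≤ M`,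
`[J : K] = p²` (namely `M`). [cite: Eichler1973, Ch. II §6, proof of Thm. 2] -/
theorem card_between_eq_one (hMK : IsLatticePair O p M K) (hp : p.Prime)
    (hidx : K.toAddSubgroup.relIndex M.toAddSubgroup = p ^ 2) :
    Nat.card {J : Submodule ℤ B // K ≤ J ∧ J ≤ M ∧ (∀ x ∈ J, ∀ o ∈ O, x * o ∈ J) ∧
        K.toAddSubgroup.relIndex J.toAddSubgroup = p ^ 2} = 1 := by
  have h := isMatrixUnitAction_actQ hmu hMK
  haveI : Finite (LatQuot M K) := Nat.finite_of_card_ne_zero (by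
    rw [card_latQuot, hidx]; exact pow_ne_zero 2 hp.ne_zero)
  have hG : Nat.card (IsMatrixUnitAction.corner (actE hmu hMK) (⊤ : AddSubgroup (LatQuot M K))) = p := by
    have := relIndex_eq_corner_sq hmu hMK
    rw [hidx] at this
    exact (Nat.pow_left_injective two_ne_zero this).symm
  rw [Nat.card_congr (betweenEquiv hmu hMK p), Nat.card_congr (h.stableEquiv p)]
  exact IsMatrixUnitAction.card_subgroups_eq_one hp _ hG

include hmu in
/-- **Count, case `[M : K] = p⁴`**: exactly `p + 1` right `O`-lattices `J` with `K ≤ J ≤ M`,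
`[J : K] = p²`. [cite: Eichler1973, Ch. II §6, proof of Thm. 2] -/
theorem card_between_eq_succ (hMK : IsLatticePair O p M K) (hp : p.Prime)
    (hidx : K.toAddSubgroup.relIndex M.toAddSubgroup = p ^ 4) :
    Nat.card {J : Submodule ℤ B // K ≤ J ∧ J ≤ M ∧ (∀ x ∈ J, ∀ o ∈ O, x * o ∈ J) ∧
        K.toAddSubgroup.relIndex J.toAddSubgroup = p ^ 2} = p + 1 := by
  have h := isMatrixUnitAction_actQ hmu hMK
  haveI : Finite (LatQuot M K) := Nat.finite_of_card_ne_zero (by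
    rw [card_latQuot, hidx]; exact pow_ne_zero 4 hp.ne_zero)
  have hG : Nat.card (IsMatrixUnitAction.corner (actE hmu hMK) (⊤ : AddSubgroup (LatQuot M K))) = p ^ 2 := by
    have := relIndex_eq_corner_sq hmu hMK
    rw [hidx, show p ^ 4 = (p ^ 2) ^ 2 by ring] at this
    exact (Nat.pow_left_injective two_ne_zero this).symm
  rw [Nat.card_congr (betweenEquiv hmu hMK p), Nat.card_congr (h.stableEquiv p)]
  exact IsMatrixUnitAction.card_subgroups_eq_succ hp _ (fun x _ => smul_latQuot_eq_zero hMK x) hG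

include hmu in
/-- **A generator modulo `p`**: if `[M : p M] = p⁴` (with `K = p M`) then some `y ∈ M` lies in no
proper right `O`-lattice `J` with `p M ≤ J ≤ M`; i.e. `M = y O + p M`. [folklore] -/
theorem exists_generator_mod (hMK : IsLatticePair O p M K) (hp : p.Prime)
    (hidx : K.toAddSubgroup.relIndex M.toAddSubgroup = p ^ 4) :
    ∃ y ∈ M, ∀ J : Submodule ℤ B, K ≤ J → J ≤ M → (∀ x ∈ J, ∀ o ∈ O, x * o ∈ J) → y ∈ J → J = M := by
  have h := isMatrixUnitAction_actQ hmu hMK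
  haveI : Finite (LatQuot M K) := Nat.finite_of_card_ne_zero (by
    rw [card_latQuot, hidx]; exact pow_ne_zero 4 hp.ne_zero)
  have hG : Nat.card (IsMatrixUnitAction.corner (actE hmu hMK) (⊤ : AddSubgroup (LatQuot M K))) = p ^ 2 := by
    have := relIndex_eq_corner_sq hmu hMK
    rw [hidx, show p ^ 4 = (p ^ 2) ^ 2 by ring] at this
    exact (Nat.pow_left_injective two_ne_zero this).symm
  obtain ⟨y₀, hy₀⟩ := h.exists_generator hp (smul_latQuot_eq_zero hMK) hG
  obtain ⟨y, rfl⟩ := QuotientAddGroup.mk'_surjective (latRes M K) y₀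
  refine ⟨y, y.2, fun J hKJ hJM hJO hyJ => ?_⟩
  have htop : subOf M K J = ⊤ := hy₀ _ (isStable_subOf hmu hMK hJO) (mem_subOf.mpr ⟨y, hyJ, rfl⟩)
  rw [← latOf_subOf hKJ hJM, htop]
  ext x
  rw [mem_latOf]
  exact ⟨fun ⟨hx, _⟩ => hx, fun hx => ⟨hx, AddSubgroup.mem_top _⟩⟩

end Action

end Literature.NumberTheory.Automorphic

end
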